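import Summits.ResolutionOfSingularities.ResolutionOfSingularities.Theorems.RadicialJungCleanModelsLocalMonomializationAlongCoarsening
import Literature.AlgebraicGeometry.Resolution.RankOneReductionProofs
import HarnessLib

/-!
# Companions of the coordinate lift: local generation of the centre of `ν₁` is TRANSPORTED along an extended centre, and SURVIVES adjoining `Y / z₀`

Route `RadicialJung`, crux `CleanModels` (stmt-ResolutionOfSingularities-15917), registered skeleton `Cruxes/CleanModels/Lines/Sketch.lean`
rev 35 (sha16 de44649d8f729c3b), stub 7 `stub_cleanModelsDimGEFour`.  Explicit-unit seat `decomp-res-hand-2` g5 (structural hand), memo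
`Cruxes/CleanModels/Lines/Sketch-memo-hand2-g5-stubs-5-7.md` §2.  OURS; structural bookkeeping, counted 0; nothing here proves resolution of
singularities in characteristic `p`.

«LocGen(A, Y)» below abbreviates (in prose only): every `π ∈ A` of positive `ν₁`-value has `s · π ∈ (Y) · A` for some `s ∈ A` with `ν(s) = 0`
— the centre of `ν₁` on `A` is generated by `Y` LOCALLY at the centre of `ν` (the hypothesis of ✓ `exists_model_centre_eq_span_of_local`).

* `locGen_of_centre_le_map` — LocGen(A, Y) and «the centre of `ν₁` on `locAtCentre A' O` is extended from `locAtCentre A O`» (the conclusion of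
  ✓ `centre_locAtCentre_adjoin_div_le_map`) give LocGen(A', Y).
* `locGen_sup_adjoin_div` — LocGen(B, Y) and a `ν₁`-unit `z₀ ∈ B` give, for `B'' = B[Y / z₀]`: `B'' ⊆ O` finitely generated,
  `locAtCentre B'' O₁ = locAtCentre B O₁`, residues unchanged, and LocGen(B'', Y / z₀).  (`(Y) = z₀ · (Y/z₀) ⊆ (Y/z₀)` and `B'' = B + (Y/z₀) B''`.)
Together with ✓ `centre_locAtCentre_adjoin_div_le_map` and ✓ `exists_model_centre_eq_span_of_local` this is the full LIFT of one residue-side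
coordinate blowing up `(z̄₀, …, z̄_s)` to the model `A[z/z₀, Y/z₀]` with model-level `𝔭 = (Y/z₀)`, `#(Y/z₀) = #Y`, same local ring at the centre
of `ν₁` (item (3d) of the g4 census). [folklore]
-/

noncomputable section

set_option linter.dupNamespace false -- mandated namespace of this single-conjunct summit

open IsLocalRing
open Literature.AlgebraicGeometry.Resolution

namespace Summit.ResolutionOfSingularities.ResolutionOfSingularities.Theorems.RadicialJung.CleanModels

variable {k K : Type} [Field k] [Field K] [Algebra k K]

/-- **LocGen is transported along an extended centre.** If the centre of `ν₁` on `A` is generated by `Y` locally at the centre of `ν`, `A ≤ A'`,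
and every element of `locAtCentre A' O` of positive `ν₁`-value lies in the extension of the centre of `ν₁` on `locAtCentre A O`, then the centre
of `ν₁` on `A'` is generated by (the image of) `Y` locally at the centre of `ν`. [folklore] -/
theorem locGen_of_centre_le_map (O O₁ : ValuationSubring K) (hO : O ≤ O₁)
    (A A' : Subalgebra k K) (hA : A.toSubring ≤ O.toSubring) (hAA' : A.toSubring ≤ A'.toSubring)
    (Y : Finset A.toSubring)
    (hloc : ∀ π : A.toSubring, O₁.valuation (π : K) < 1 →
      ∃ s : A.toSubring, O.valuation (s : K) = 1 ∧ s * π ∈ Ideal.span (Y : Set A.toSubring))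
    (hext : ∀ f : locAtCentre A'.toSubring O, O₁.valuation (f : K) < 1 →
      f ∈ ((maximalIdeal O₁).comap (Subring.inclusion ((locAtCentre_le hA).trans hO))).map
        (Subring.inclusion (locAtCentre_mono O hAA'))) :
    ∀ π : A'.toSubring, O₁.valuation (π : K) < 1 →
      ∃ s : A'.toSubring, O.valuation (s : K) = 1 ∧
        s * π ∈ Ideal.span ((Y.map ⟨Subring.inclusion hAA', Subring.inclusion_injective hAA'⟩ : Finset A'.toSubring) : Set A'.toSubring) := by
  classical
  set L := locAtCentre A.toSubring O with hLdef
  set L' := locAtCentre A'.toSubring O with hL'def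
  have hLL' : L ≤ L' := locAtCentre_mono O hAA'
  let ι : L →+* L' := Subring.inclusion hLL'
  let incl : A.toSubring →+* A'.toSubring := Subring.inclusion hAA'
  set PL : Ideal L := (maximalIdeal O₁).comap (Subring.inclusion ((locAtCentre_le hA).trans hO)) with hPLdef
  have hmemPL : ∀ f : L, f ∈ PL ↔ O₁.valuation (f : K) < 1 := fun f => by
    rw [hPLdef, Ideal.mem_comap, ValuationSubring.valuation_lt_one_iff]; rfl
  set Y' : Finset A'.toSubring := Y.map ⟨incl, Subring.inclusion_injective hAA'⟩ with hY'def
  set I' : Ideal A'.toSubring := Ideal.span (Y' : Set A'.toSubring) with hI'def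
  have hYI' : (Ideal.span (Y : Set A.toSubring)).map incl ≤ I' := by
    rw [Ideal.map_span, Ideal.span_le]
    rintro _ ⟨y, hy, rfl⟩
    exact Ideal.subset_span (Finset.mem_map.mpr ⟨y, hy, rfl⟩)
  -- the predicate: `x ∈ L'` is «locally in `I'`»
  let Pr : L' → Prop := fun x => ∃ s : A'.toSubring, O.valuation (s : K) = 1 ∧ ∃ q : A'.toSubring, q ∈ I' ∧ (q : K) = (s : K) * (x : K)
  have hPr_zero : Pr 0 := ⟨1, by simp, 0, I'.zero_mem, by simp⟩
  have hPr_add : ∀ x y, Pr x → Pr y → Pr (x + y) := by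
    rintro x y ⟨s, hs, q, hq, hqx⟩ ⟨s', hs', q', hq', hqy⟩
    refine ⟨s * s', by rw [Subring.coe_mul, map_mul, hs, hs', one_mul], s' * q + s * q', I'.add_mem (I'.mul_mem_left _ hq) (I'.mul_mem_left _ hq'), ?_⟩
    push_cast
    rw [hqx, hqy]; ring
  have hPr_smul : ∀ (r : L') x, Pr x → Pr (r * x) := by
    rintro r x ⟨s, hs, q, hq, hqx⟩
    obtain ⟨a, ha, e, he, he1, hr⟩ := (mem_locAtCentre_iff).mp r.2
    refine ⟨⟨e, he⟩ * s, by rw [Subring.coe_mul, map_mul, he1, hs, one_mul], ⟨a, ha⟩ * q, I'.mul_mem_left _ hq, ?_⟩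
    push_cast
    rw [hqx, hr]
    have := ne_zero_of_valuation_eq_one he1
    field_simp
  have hPr_gen : ∀ p : L, p ∈ PL → Pr (ι p) := by
    intro p hp
    obtain ⟨a, ha, e, he, he1, hpa⟩ := (mem_locAtCentre_iff).mp p.2
    have he0 := ne_zero_of_valuation_eq_one he1
    have haval : O₁.valuation a < 1 := by
      have h1 := (hmemPL p).mp hp
      have heO₁ : O₁.valuation e = 1 := by
        apply le_antisymm ((O₁.valuation_le_one_iff _).mpr (hO (hA he)))
        have hinvO : e⁻¹ ∈ O := (O.valuation_le_one_iff _).mp (by rw [map_inv₀, he1, inv_one])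
        have h2 : O₁.valuation e⁻¹ ≤ 1 := (O₁.valuation_le_one_iff _).mpr (hO hinvO)
        rw [map_inv₀] at h2
        exact (inv_le_one₀ (by rw [Valuation.pos_iff]; exact he0)).mp h2
      have : O₁.valuation (p : K) = O₁.valuation a := by rw [hpa, map_div₀, heO₁, div_one]
      rw [← this]; exact h1
    obtain ⟨s, hs, hsa⟩ := hloc ⟨a, ha⟩ haval
    refine ⟨incl (s * ⟨e, he⟩), by change O.valuation ((s : K) * e) = 1; rw [map_mul, hs, he1, one_mul],
      incl (s * ⟨a, ha⟩), hYI' (Ideal.mem_map_of_mem incl hsa), ?_⟩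
    change (s : K) * a = (s : K) * e * (p : K)
    rw [hpa]; field_simp
  intro π hπ
  let πL : L' := ⟨(π : K), le_locAtCentre _ _ π.2⟩
  have hπL : πL ∈ PL.map ι := hext πL hπ
  have key : Pr πL := by
    rw [Ideal.map] at hπL
    refine Submodule.span_induction (p := fun x _ => Pr x) ?_ hPr_zero (fun x y _ _ => hPr_add x y) (fun r x _ => hPr_smul r x) hπL
    rintro _ ⟨p, hp, rfl⟩
    exact hPr_gen p hp
  obtain ⟨s, hs, q, hq, hqx⟩ := key
  refine ⟨s, hs, ?_⟩
  have : s * π = q := Subtype.ext (by rw [Subring.coe_mul, hqx])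
  rw [this]; exact hq

/-- **LocGen survives adjoining `Y / z₀`.** If the centre of `ν₁` on `B` is generated by `Y` locally at the centre of `ν` and `z₀ ∈ B` is a
`ν₁`-unit, then `B'' = B[Y / z₀]` is a finitely generated model inside `O` with the same local ring at the centre of `ν₁`, the same residues in
`κ(O₁)`, and its centre of `ν₁` is generated by `Y / z₀` locally at the centre of `ν` (`#(Y/z₀) = #Y`). [folklore] -/
theorem locGen_sup_adjoin_div (O O₁ : ValuationSubring K) (hO : O ≤ O₁)
    (B : Subalgebra k K) (hB : B.toSubring ≤ O.toSubring) (hBfg : B.FG)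
    (Y : Finset B.toSubring) (hYP : ∀ y ∈ Y, O₁.valuation ((y : B.toSubring) : K) < 1)
    (hloc : ∀ π : B.toSubring, O₁.valuation (π : K) < 1 →
      ∃ s : B.toSubring, O.valuation (s : K) = 1 ∧ s * π ∈ Ideal.span (Y : Set B.toSubring))
    (z₀ : K) (hz₀B : z₀ ∈ B) (hz₀P : O₁.valuation z₀ = 1) :
    ∃ (hB'' : (B ⊔ Algebra.adjoin k ((fun y : B.toSubring => (y : K) / z₀) '' (Y : Set B.toSubring))).toSubring ≤ O.toSubring),
      (B ⊔ Algebra.adjoin k ((fun y : B.toSubring => (y : K) / z₀) '' (Y : Set B.toSubring))).FG ∧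
      locAtCentre (B ⊔ Algebra.adjoin k ((fun y : B.toSubring => (y : K) / z₀) '' (Y : Set B.toSubring))).toSubring O₁ =
        locAtCentre B.toSubring O₁ ∧
      (∀ x : (B ⊔ Algebra.adjoin k ((fun y : B.toSubring => (y : K) / z₀) '' (Y : Set B.toSubring))).toSubring, ∃ c : B.toSubring,
        ((residue O₁).comp (Subring.inclusion (hB''.trans hO))) x = ((residue O₁).comp (Subring.inclusion (hB.trans hO))) c) ∧
      ∃ Y'' : Finset (B ⊔ Algebra.adjoin k ((fun y : B.toSubring => (y : K) / z₀) '' (Y : Set B.toSubring))).toSubring,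
        Y''.card = Y.card ∧
        (∀ y'', y'' ∈ Y'' ↔ ∃ y ∈ Y, ((y : B.toSubring) : K) / z₀ = (y'' : K)) ∧
        (∀ y'' ∈ Y'', O₁.valuation ((y'' : _) : K) < 1) ∧
        ∀ π : (B ⊔ Algebra.adjoin k ((fun y : B.toSubring => (y : K) / z₀) '' (Y : Set B.toSubring))).toSubring,
          O₁.valuation (π : K) < 1 →
          ∃ s : (B ⊔ Algebra.adjoin k ((fun y : B.toSubring => (y : K) / z₀) '' (Y : Set B.toSubring))).toSubring,
            O.valuation (s : K) = 1 ∧ s * π ∈ Ideal.span (Y'' : Set _) := by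
  classical
  set B'' := B ⊔ Algebra.adjoin k ((fun y : B.toSubring => (y : K) / z₀) '' (Y : Set B.toSubring)) with hB''def
  have hBB'' : B ≤ B'' := le_sup_left
  have hBB''' : B.toSubring ≤ B''.toSubring := fun x hx => hBB'' hx
  have hz₀0 : z₀ ≠ 0 := ne_zero_of_valuation_eq_one hz₀P
  let w₀ : B.toSubring → K := fun y => (y : K) / z₀
  have hw₀val : ∀ y ∈ Y, O₁.valuation (w₀ y) < 1 := fun y hy => by
    simp only [w₀, map_div₀, hz₀P, div_one]; exact hYP y hy
  have hw₀O : ∀ y ∈ Y, w₀ y ∈ O := fun y hy =>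
    mem_of_mem_maximalIdeal_of_le O O₁ hO ⟨w₀ y, (O₁.valuation_le_one_iff _).mp (hw₀val y hy).le⟩
      (by rw [ValuationSubring.valuation_lt_one_iff]; exact hw₀val y hy)
  have hk : ∀ c : k, algebraMap k K c ∈ O := fun c => hB (B.algebraMap_mem c)
  have hB''O : B''.toSubring ≤ O.toSubring := by
    have : B'' ≤ ({ O.toSubring with algebraMap_mem' := hk } : Subalgebra k K) := by
      refine sup_le (fun x hx => hB hx) (Algebra.adjoin_le ?_)
      rintro _ ⟨y, hy, rfl⟩; exact hw₀O y hy
    exact fun x hx => this hx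
  have hB''O₁ : B''.toSubring ≤ O₁.toSubring := hB''O.trans hO
  have hB''fg : B''.FG := by
    have : Algebra.adjoin k ((fun y : B.toSubring => (y : K) / z₀) '' (Y : Set B.toSubring)) =
        Algebra.adjoin k ((Y.image w₀ : Finset K) : Set K) := by rw [Finset.coe_image]
    rw [hB''def, this]; exact hBfg.sup ⟨_, rfl⟩
  have hwB'' : ∀ y ∈ Y, w₀ y ∈ B'' := fun y hy =>
    (le_sup_right : Algebra.adjoin k _ ≤ B'') (Algebra.subset_adjoin ⟨y, hy, rfl⟩)
  -- (α)
  have hα : locAtCentre B''.toSubring O₁ = locAtCentre B.toSubring O₁ := by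
    refine locAtCentre_eq_of_mutual_le O₁ B''.toSubring B.toSubring ?_ (fun x hx => le_locAtCentre _ _ (hBB''' hx))
    let R₁ : Subalgebra k K :=
      ({ locAtCentre B.toSubring O₁ with
          algebraMap_mem' := fun c => le_locAtCentre B.toSubring O₁ (B.algebraMap_mem c) } : Subalgebra k K)
    have : B'' ≤ R₁ := by
      refine sup_le (fun x hx => le_locAtCentre B.toSubring O₁ hx) (Algebra.adjoin_le ?_)
      rintro _ ⟨y, hy, rfl⟩
      exact ⟨y, y.2, z₀, hz₀B, hz₀P, rfl⟩
    exact fun x hx => this hx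
  -- the ideal `J = (Y/z₀) B''` and the decomposition `B'' = B + J`
  let incl : B.toSubring →+* B''.toSubring := Subring.inclusion hBB'''
  let f : {y // y ∈ Y} → B''.toSubring := fun y => ⟨w₀ y, hwB'' y y.2⟩
  have hf_inj : Function.Injective f := by
    intro y y' h
    have h1 : w₀ y = w₀ y' := congrArg Subtype.val h
    have h2 : ((y : B.toSubring) : K) = ((y' : B.toSubring) : K) := by
      simp only [w₀] at h1
      field_simp at h1
      exact h1
    exact Subtype.ext (Subtype.ext h2)
  let Y'' : Finset B''.toSubring := Y.attach.map ⟨f, hf_inj⟩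
  set J : Ideal B''.toSubring := Ideal.span (Y'' : Set B''.toSubring) with hJdef
  have hmemY'' : ∀ y'', y'' ∈ Y'' ↔ ∃ y ∈ Y, ((y : B.toSubring) : K) / z₀ = (y'' : K) := by
    intro y''
    constructor
    · intro h
      obtain ⟨⟨y, hy⟩, -, rfl⟩ := Finset.mem_map.mp h
      exact ⟨y, hy, rfl⟩
    · rintro ⟨y, hy, hyy⟩
      exact Finset.mem_map.mpr ⟨⟨y, hy⟩, Finset.mem_attach _ _, Subtype.ext hyy⟩
  have hwJ : ∀ y (hy : y ∈ Y), (⟨w₀ y, hwB'' y hy⟩ : B''.toSubring) ∈ J := fun y hy =>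
    Ideal.subset_span (Finset.mem_map.mpr ⟨⟨y, hy⟩, Finset.mem_attach _ _, rfl⟩)
  have hY''val : ∀ y'' ∈ Y'', O₁.valuation ((y'' : B''.toSubring) : K) < 1 := by
    intro y'' hy''
    obtain ⟨y, hy, hyy⟩ := (hmemY'' y'').mp hy''
    rw [← hyy]; exact hw₀val y hy
  set P'' : Ideal B''.toSubring := (maximalIdeal O₁).comap (Subring.inclusion hB''O₁) with hP''def
  have hmemP'' : ∀ g : B''.toSubring, g ∈ P'' ↔ O₁.valuation (g : K) < 1 := fun g => by
    rw [hP''def, Ideal.mem_comap, ValuationSubring.valuation_lt_one_iff]; rfl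
  have hJP'' : J ≤ P'' := by
    rw [hJdef, Ideal.span_le]
    intro y'' hy''
    rw [SetLike.mem_coe, hmemP'']
    exact hY''val y'' hy''
  have hJval : ∀ j ∈ J, O₁.valuation ((j : B''.toSubring) : K) < 1 := fun j hj => (hmemP'' j).mp (hJP'' hj)
  have hYJ : (Ideal.span (Y : Set B.toSubring)).map incl ≤ J := by
    rw [Ideal.map_span, Ideal.span_le]
    rintro _ ⟨y, hy, rfl⟩
    have : incl y = ⟨z₀, hBB'' hz₀B⟩ * ⟨w₀ y, hwB'' y hy⟩ := by
      apply Subtype.ext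
      change ((y : B.toSubring) : K) = z₀ * (((y : B.toSubring) : K) / z₀)
      field_simp
    rw [SetLike.mem_coe, this]
    exact J.mul_mem_left _ (hwJ y hy)
  have hdecomp : ∀ x : B''.toSubring, ∃ c : B.toSubring, x - incl c ∈ J := by
    let T : Subalgebra k K :=
      { carrier := {x | ∃ X : B''.toSubring, (X : K) = x ∧ ∃ c : B.toSubring, X - incl c ∈ J}
        mul_mem' := by
          rintro _ _ ⟨X, rfl, c, hc⟩ ⟨X', rfl, c', hc'⟩
          refine ⟨X * X', rfl, c * c', ?_⟩
          have : X * X' - incl (c * c') = (X - incl c) * X' + incl c * (X' - incl c') := by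
            rw [map_mul]; ring
          rw [this]
          exact J.add_mem (J.mul_mem_right _ hc) (J.mul_mem_left _ hc')
        one_mem' := ⟨1, rfl, 1, by rw [map_one, sub_self]; exact J.zero_mem⟩
        add_mem' := by
          rintro _ _ ⟨X, rfl, c, hc⟩ ⟨X', rfl, c', hc'⟩
          refine ⟨X + X', rfl, c + c', ?_⟩
          have : X + X' - incl (c + c') = (X - incl c) + (X' - incl c') := by
            rw [map_add]; ring
          rw [this]
          exact J.add_mem hc hc'
        zero_mem' := ⟨0, rfl, 0, by rw [map_zero, sub_self]; exact J.zero_mem⟩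
        algebraMap_mem' := fun c₀ => by
          refine ⟨⟨algebraMap k K c₀, B''.algebraMap_mem c₀⟩, rfl,
            ⟨algebraMap k K c₀, B.algebraMap_mem c₀⟩, ?_⟩
          have e : incl ⟨algebraMap k K c₀, B.algebraMap_mem c₀⟩ =
              (⟨algebraMap k K c₀, B''.algebraMap_mem c₀⟩ : B''.toSubring) := Subtype.ext rfl
          rw [e, sub_self]; exact J.zero_mem }
    have hB''T : B'' ≤ T := by
      refine sup_le (fun x hx => ?_) (Algebra.adjoin_le ?_)
      · refine ⟨⟨x, hBB'' hx⟩, rfl, ⟨x, hx⟩, ?_⟩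
        have e : incl ⟨x, hx⟩ = (⟨x, hBB'' hx⟩ : B''.toSubring) := Subtype.ext rfl
        rw [e, sub_self]; exact J.zero_mem
      · rintro _ ⟨y, hy, rfl⟩
        exact ⟨⟨w₀ y, hwB'' y hy⟩, rfl, 0, by rw [map_zero, sub_zero]; exact hwJ y hy⟩
    intro x
    obtain ⟨X, hX, c, hc⟩ := hB''T x.2
    have : X = x := Subtype.ext hX
    exact ⟨c, this ▸ hc⟩
  -- residues unchanged
  have hres : ∀ x : B''.toSubring, ∃ c : B.toSubring,
      ((residue O₁).comp (Subring.inclusion hB''O₁)) x = ((residue O₁).comp (Subring.inclusion (hB.trans hO))) c := by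
    intro x
    obtain ⟨c, hc⟩ := hdecomp x
    refine ⟨c, ?_⟩
    have h0 : ((residue O₁).comp (Subring.inclusion hB''O₁)) (x - incl c) = 0 :=
      (residue_inclusion_eq_zero_iff O₁ B'' hB''O₁ _).mpr (hJP'' hc)
    rw [map_sub, sub_eq_zero] at h0
    exact h0
  refine ⟨hB''O, hB''fg, hα, hres, Y'', ?_, hmemY'', hY''val, ?_⟩
  · simp only [Y'', Finset.card_map, Finset.card_attach]
  · intro π hπ
    obtain ⟨c, hc⟩ := hdecomp π
    have hcval : O₁.valuation (c : K) < 1 := by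
      have h1 : O₁.valuation ((π : K) - (c : K)) < 1 := by
        have := hJval _ hc
        rwa [AddSubgroupClass.coe_sub] at this
      have : (c : K) = π - (π - (c : K)) := by ring
      rw [this]
      exact lt_of_le_of_lt (Valuation.map_sub _ _ _) (max_lt hπ h1)
    obtain ⟨s, hs, hsc⟩ := hloc c hcval
    refine ⟨incl s, hs, ?_⟩
    have : incl s * π = incl (s * c) + incl s * (π - incl c) := by rw [map_mul]; ring
    rw [this]
    exact J.add_mem (hYJ (Ideal.mem_map_of_mem incl hsc)) (J.mul_mem_left _ hc)

end Summit.ResolutionOfSingularities.ResolutionOfSingularities.Theorems.RadicialJung.CleanModels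

end
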